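import Summits.Parity.GeneralizedHardyLittlewood.Theorems.LiouvilleShiftedTablesSieveToMAvgTypeIIBlocks

/-!
# Sieve glue for `SieveToMAvg`, part 6d: Type II — summing the main pieces

Support file for item stmt-Parity-14274 (route `LiouvilleShiftedTables`).  From the block bound of
part 6c and Hölder (part 6b): for each fine piece `k` whose box meets the support of `α`,
`∑_{q} |main_{k,q}| ≤ ‖α_k‖ ‖β‖ (X²/(log X)^C)^{1/4} (∑_{q≤Q} 1/q)^{3/4}`, and summing over `k`
with `∑_k ‖α_k‖ ≤ √K₁ ‖α‖` gives the Type-II main-term bound `sum_sum_abs_mainPiece_le`.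
-/

namespace Summit.Parity.GeneralizedHardyLittlewood.Theorems.SieveToMAvg

open Finset Real
open scoped ArithmeticFunction.zeta ArithmeticFunction.sigma
open Literature.NumberTheory.Sieve.BFI

section Sum

variable {h : ℕ} {x X A₂ Δ₁ δ C : ℝ} {α β : ArithmeticFunction ℝ}

/-- **One piece, all moduli**: under `HypII X (−h) δ C`, if the `k`-th box is either off the support
of `α` or has `lo ∈ [X^δ, X^{1/3+δ}]`, `lo ≥ 2`, then
`∑_{q ∈ moduli Q h} |main_{k,q}| ≤ ‖α_k‖ ‖β‖ (X²/(log X)^C)^{1/4} (∑_{q≤Q} 1/q)^{3/4}`. [folklore] -/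
theorem sum_abs_mainPiece_le (hyp : HypII X (-(h : ℤ)) δ C) (hX : 1 ≤ X) (hx : 0 < x) (hxX : 2 * x ≤ X)
    (hA₂x : A₂ ≤ 2 * x) (hΔ₁ : 0 < Δ₁) (hΔ₁' : Δ₁ ≤ 1 / 2) {Q : ℕ} (hQ : Q ≤ ⌊X ^ (δ / 2)⌋₊) (k : ℕ)
    (hk : (∀ a, boxRestrict A₂ Δ₁ k α a = 0) ∨
      (X ^ δ ≤ boxLow A₂ Δ₁ k ∧ boxLow A₂ Δ₁ k ≤ X ^ (1 / 3 + δ) ∧ 2 ≤ boxLow A₂ Δ₁ k)) :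
    ∑ q ∈ moduli Q h, |mainPiece h q x A₂ Δ₁ α β k| ≤
      Real.sqrt (∑ a ∈ Ioc 0 ⌊2 * x⌋₊, (boxRestrict A₂ Δ₁ k α a) ^ 2) *
        Real.sqrt (∑ b ∈ Ioc 0 ⌊2 * x⌋₊, (β b) ^ 2) *
          ((X ^ 2 / Real.log X ^ C) ^ ((1 : ℝ) / 4) * (∑ q ∈ Icc 1 Q, (q : ℝ)⁻¹) ^ ((3 : ℝ) / 4)) := by
  have hrhs0 : 0 ≤ Real.sqrt (∑ a ∈ Ioc 0 ⌊2 * x⌋₊, (boxRestrict A₂ Δ₁ k α a) ^ 2) *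
        Real.sqrt (∑ b ∈ Ioc 0 ⌊2 * x⌋₊, (β b) ^ 2) *
          ((X ^ 2 / Real.log X ^ C) ^ ((1 : ℝ) / 4) * (∑ q ∈ Icc 1 Q, (q : ℝ)⁻¹) ^ ((3 : ℝ) / 4)) := by
    have h1 : 0 ≤ X ^ 2 / Real.log X ^ C :=
      div_nonneg (pow_nonneg (by linarith) 2) (Real.rpow_nonneg (Real.log_nonneg hX) C)
    have h2 : 0 ≤ ∑ q ∈ Icc 1 Q, (q : ℝ)⁻¹ := Finset.sum_nonneg fun q _ => by positivity
    positivity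
  rcases hk with hzero | ⟨hlo1, hlo2, hlo3⟩
  · -- the piece vanishes identically
    have hmain : ∀ q, mainPiece h q x A₂ Δ₁ α β k = 0 := by
      intro q
      unfold mainPiece
      refine Finset.sum_eq_zero fun a _ => Finset.sum_eq_zero fun b _ => ?_
      rw [hzero a]; simp
    simp only [hmain, abs_zero, Finset.sum_const_zero]
    exact hrhs0
  · have hs : moduli Q h ⊆ Icc 1 Q := Finset.filter_subset _ _
    calc ∑ q ∈ moduli Q h, |mainPiece h q x A₂ Δ₁ α β k|
        ≤ ∑ q ∈ moduli Q h, Real.sqrt (∑ a ∈ Ioc 0 ⌊2 * x⌋₊, (boxRestrict A₂ Δ₁ k α a) ^ 2) *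
            Real.sqrt (∑ b ∈ Ioc 0 ⌊2 * x⌋₊, (β b) ^ 2) *
              Fstar X (-(h : ℤ)) q (boxLow A₂ Δ₁ k) ^ ((1 : ℝ) / 4) := by
          refine Finset.sum_le_sum fun q hq => ?_
          obtain ⟨⟨hq1, -⟩, hqh⟩ := mem_moduli.1 hq
          exact abs_mainPiece_le (by omega) hqh.symm hx hxX hA₂x hΔ₁ hΔ₁' k hlo3
      _ = Real.sqrt (∑ a ∈ Ioc 0 ⌊2 * x⌋₊, (boxRestrict A₂ Δ₁ k α a) ^ 2) *
            Real.sqrt (∑ b ∈ Ioc 0 ⌊2 * x⌋₊, (β b) ^ 2) *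
              ∑ q ∈ moduli Q h, Fstar X (-(h : ℤ)) q (boxLow A₂ Δ₁ k) ^ ((1 : ℝ) / 4) := by
          rw [Finset.mul_sum]
      _ ≤ _ := mul_le_mul_of_nonneg_left (sum_Fstar_rpow_le hyp hX hlo1 hlo2 hQ hs) (by positivity)

/-- `∑_{k<K₁} (α_k(a))² = α(a)²` for `α` supported on `a ≤ A₂ < (1+Δ₁)^{K₁}`. [folklore] -/
theorem sum_sq_boxRestrict_eq (hA₂ : 0 < A₂) (hΔ₁ : 0 < Δ₁) {K₁ : ℕ} (hK₁ : A₂ < (1 + Δ₁) ^ K₁)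
    (hα : ∀ a : ℕ, α a ≠ 0 → (a : ℝ) ≤ A₂) (a : ℕ) :
    ∑ k ∈ Finset.range K₁, (boxRestrict A₂ Δ₁ k α a) ^ 2 = (α a) ^ 2 := by
  by_cases h0 : α a = 0
  · rw [h0]
    simp only [boxRestrict_apply, h0, ite_self, ne_eq, OfNat.ofNat_ne_zero, not_false_eq_true, zero_pow,
      Finset.sum_const_zero]
  have ha1 : 1 ≤ a := by
    rcases Nat.eq_zero_or_pos a with rfl | h
    · exact absurd (by simp) h0
    · exact h
  have hsq : ∀ k, (boxRestrict A₂ Δ₁ k α a) ^ 2 = boxRestrict A₂ Δ₁ k (α.pmul α) a := by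
    intro k
    rw [boxRestrict_apply, boxRestrict_apply, ArithmeticFunction.pmul_apply]
    split_ifs <;> ring
  rw [Finset.sum_congr rfl fun k _ => hsq k, sum_boxRestrict_apply hA₂ hΔ₁ hK₁ (α.pmul α) ha1 (hα a h0),
    ArithmeticFunction.pmul_apply, sq]

/-- **Type II, the main pieces summed** (all `q ∈ moduli Q h`, all pieces `k < K₁`): for `α`
supported on `[A₁, A₂]` with `(1+Δ₁) X^δ ≤ A₁`, `A₂ ≤ X^{1/3+δ}`, `A₂ ≤ 2x`, `2 ≤ X^δ`,
`∑_q ∑_k |main_{k,q}| ≤ √K₁ ‖α‖₂ ‖β‖₂ (X²/(log X)^C)^{1/4} (∑_{q≤Q} 1/q)^{3/4}`. [folklore] -/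
theorem sum_sum_abs_mainPiece_le (hyp : HypII X (-(h : ℤ)) δ C) (hX : 1 ≤ X) (hx : 0 < x) (hxX : 2 * x ≤ X)
    (hΔ₁ : 0 < Δ₁) (hΔ₁' : Δ₁ ≤ 1 / 2) {Q : ℕ} (hQ : Q ≤ ⌊X ^ (δ / 2)⌋₊) {A₁ : ℝ} {K₁ : ℕ}
    (hα : ∀ a : ℕ, α a ≠ 0 → A₁ ≤ (a : ℝ) ∧ (a : ℝ) ≤ A₂) (hA₁ : (1 + Δ₁) * X ^ δ ≤ A₁)
    (hA₂ : A₂ ≤ X ^ (1 / 3 + δ)) (hA₂x : A₂ ≤ 2 * x) (h2 : 2 ≤ X ^ δ) (hA₂0 : 0 < A₂)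
    (hK₁ : A₂ < (1 + Δ₁) ^ K₁) :
    ∑ q ∈ moduli Q h, ∑ k ∈ Finset.range K₁, |mainPiece h q x A₂ Δ₁ α β k| ≤
      Real.sqrt K₁ * Real.sqrt (∑ a ∈ Ioc 0 ⌊2 * x⌋₊, (α a) ^ 2) *
        Real.sqrt (∑ b ∈ Ioc 0 ⌊2 * x⌋₊, (β b) ^ 2) *
          ((X ^ 2 / Real.log X ^ C) ^ ((1 : ℝ) / 4) * (∑ q ∈ Icc 1 Q, (q : ℝ)⁻¹) ^ ((3 : ℝ) / 4)) := by
  set W : ℝ := Real.sqrt (∑ b ∈ Ioc 0 ⌊2 * x⌋₊, (β b) ^ 2) *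
    ((X ^ 2 / Real.log X ^ C) ^ ((1 : ℝ) / 4) * (∑ q ∈ Icc 1 Q, (q : ℝ)⁻¹) ^ ((3 : ℝ) / 4)) with hW
  set nk : ℕ → ℝ := fun k => Real.sqrt (∑ a ∈ Ioc 0 ⌊2 * x⌋₊, (boxRestrict A₂ Δ₁ k α a) ^ 2) with hnk
  have hW0 : 0 ≤ W := by
    have h1 : 0 ≤ X ^ 2 / Real.log X ^ C :=
      div_nonneg (pow_nonneg (by linarith) 2) (Real.rpow_nonneg (Real.log_nonneg hX) C)
    have h2' : 0 ≤ ∑ q ∈ Icc 1 Q, (q : ℝ)⁻¹ := Finset.sum_nonneg fun q _ => by positivity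
    positivity
  -- each piece is admissible
  have hk : ∀ k, (∀ a, boxRestrict A₂ Δ₁ k α a = 0) ∨
      (X ^ δ ≤ boxLow A₂ Δ₁ k ∧ boxLow A₂ Δ₁ k ≤ X ^ (1 / 3 + δ) ∧ 2 ≤ boxLow A₂ Δ₁ k) := by
    intro k
    by_cases hz : ∀ a, boxRestrict A₂ Δ₁ k α a = 0
    · exact Or.inl hz
    right
    push Not at hz
    obtain ⟨a, ha⟩ := hz
    obtain ⟨hin, hαa⟩ := boxRestrict_ne_zero ha
    obtain ⟨hA₁a, haA₂⟩ := hα a hαa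
    have hΔ' : (-1 : ℝ) < Δ₁ := by linarith
    obtain ⟨_, hlo, hhi⟩ := hin
    rw [boxHigh_eq_mul_boxLow hΔ'] at hhi
    have hlo1 : X ^ δ ≤ boxLow A₂ Δ₁ k := by
      -- `(1+Δ₁) X^δ ≤ A₁ ≤ a ≤ (1+Δ₁) lo`
      have : (1 + Δ₁) * X ^ δ ≤ (1 + Δ₁) * boxLow A₂ Δ₁ k := by linarith
      exact le_of_mul_le_mul_left this (by linarith)
    exact ⟨hlo1, by linarith, h2.trans hlo1⟩
  -- swap the sums and bound each piece
  rw [Finset.sum_comm]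
  calc ∑ k ∈ Finset.range K₁, ∑ q ∈ moduli Q h, |mainPiece h q x A₂ Δ₁ α β k|
      ≤ ∑ k ∈ Finset.range K₁, nk k * W := by
        refine Finset.sum_le_sum fun k _ => ?_
        have := sum_abs_mainPiece_le (β := β) hyp hX hx hxX hA₂x hΔ₁ hΔ₁' hQ k (hk k)
        simpa only [hnk, hW, mul_assoc] using this
    _ = (∑ k ∈ Finset.range K₁, Real.sqrt 1 * nk k) * W := by
        rw [Finset.sum_mul]; simp
    _ ≤ (Real.sqrt (∑ _k ∈ Finset.range K₁, (1 : ℝ)) *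
          Real.sqrt (∑ k ∈ Finset.range K₁, ∑ a ∈ Ioc 0 ⌊2 * x⌋₊, (boxRestrict A₂ Δ₁ k α a) ^ 2)) * W := by
        refine mul_le_mul_of_nonneg_right ?_ hW0
        exact Real.sum_sqrt_mul_sqrt_le (Finset.range K₁) (fun _ => zero_le_one)
          (fun k => Finset.sum_nonneg fun _ _ => sq_nonneg _)
    _ = Real.sqrt K₁ * Real.sqrt (∑ a ∈ Ioc 0 ⌊2 * x⌋₊, (α a) ^ 2) * W := by
        congr 2
        · simp
        · rw [Finset.sum_comm]
          congr 1
          exact Finset.sum_congr rfl fun a _ => sum_sq_boxRestrict_eq hA₂0 hΔ₁ hK₁ (fun a ha => (hα a ha).2) a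
    _ = _ := by simp only [hW]; ring

end Sum

end Summit.Parity.GeneralizedHardyLittlewood.Theorems.SieveToMAvg
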